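import Summits.BirchSwinnertonDyer.BirchSwinnertonDyer.Theorems.Rank2Observatory2DescClPrimesOver
import HarnessLib

/-!
# BSD rank-2 observatory — kernel 2DESC-CL: the primes above a totally split prime, certified
**without Dedekind–Kummer** (norm certificate; cut 2c-B = common index divisor)

Cell `b2b-bsdr2`, row `cert-1` (2-descent in `K = ℚ(E[2])`, **even** class number), generic layer.
Honest framing: per-curve certified theorems and census instruments; **no claim on BSD in
rank ≥ 2**.

In a cubic field in which `2` splits completely, `2` divides the index of *every* order `ℤ[θ]`
(`2` is a common index divisor), so the Dedekind–Kummer factorisation of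
`Rank2Observatory2DescClPrimesOver` is unavailable at `p = 2` for any generator.  This file
certifies the three primes above such a prime from **element data only**: three elements
`G₀, G₁, G₂` with `G₀·G₁·G₂ = p·H` and `|N(Gᵢ)| = p·mᵢ`, `p ∤ mᵢ`.  Then each `Pᵢ = (p, Gᵢ)` has
`N(Pᵢ) ∣ gcd(p³, p·mᵢ) = p`, the product `P₀P₁P₂ ≤ (p)` forces `p³ ∣ N(P₀)N(P₁)N(P₂)`, hence
`N(Pᵢ) = p` for all `i`: each `Pᵢ` is a prime of norm `p`, and every prime containing `p` contains
some `Gᵢ`, hence equals `Pᵢ` (`exists_eq_span_pair_of_prod_eq`).  The conclusion has exactly the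
shape of `primesOver_split`, so the per-field registry code is unchanged downstream.

* `span_pair_mul_three_le` — `(p,G₀)(p,G₁)(p,G₂) ≤ (p)` from `G₀G₁G₂ = pH`. [folklore]
* `absNorm_span_pair_dvd_natAbs_norm`, `absNorm_span_pair_dvd_pow` — `N((p,x)) ∣ |N(x)|`,
  `N((p,x)) ∣ p^{[K:ℚ]}`. [folklore]
* `primesOver_three_of_normCert` — the certificate; `heightOneSpectrum_eq_or_eq_or_eq`,
  `ne_of_sub_eq_one` — covering / distinctness glue. [folklore]
[cite: Cohen1993, §4.8.2 (prime decomposition when `p` divides the index), §6.2.2;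
 Marcus2018, Ch. 3, Thm. 22 (norms of primes), Ex. 27 (common index divisors)]

## References
* H. Cohen, *A Course in Computational Algebraic Number Theory*, GTM 138 (1993), §4.8.2, §6.2.
  [Cohen1993]
* D. A. Marcus, *Number Fields*, 2nd ed. (2018), Ch. 3. [Marcus2018]
-/

-- single-conjunct summit: `Summit.BirchSwinnertonDyer.BirchSwinnertonDyer.…` repeats the name by design
set_option linter.dupNamespace false

noncomputable section

open scoped Classical NumberField nonZeroDivisors

namespace Summit.BirchSwinnertonDyer.BirchSwinnertonDyer.Rank2Observatory.TwoDescCl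

open IsDedekindDomain NumberField Ideal
open Literature.NumberTheory.NumberFields

variable {K : Type*} [Field K] [NumberField K]

omit [NumberField K] in
/-- **`(p,G₀)(p,G₁)(p,G₂) ≤ (p)`** when `G₀G₁G₂ = pH`. [folklore] -/
theorem span_pair_mul_three_le {p G₀ G₁ G₂ H : 𝓞 K} (h : G₀ * G₁ * G₂ = p * H) :
    span {p, G₀} * span {p, G₁} * span {p, G₂} ≤ span {p} := by
  have key : ∀ x ∈ span ({p, G₀} : Set (𝓞 K)), ∀ y ∈ span ({p, G₁} : Set (𝓞 K)),
      ∀ z ∈ span ({p, G₂} : Set (𝓞 K)), x * y * z ∈ span ({p} : Set (𝓞 K)) := by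
    intro x hx y hy z hz
    rw [mem_span_pair] at hx hy hz
    obtain ⟨a₀, b₀, rfl⟩ := hx
    obtain ⟨a₁, b₁, rfl⟩ := hy
    obtain ⟨a₂, b₂, rfl⟩ := hz
    refine mem_span_singleton'.mpr ⟨a₀ * (a₁ * p + b₁ * G₁) * (a₂ * p + b₂ * G₂) +
      b₀ * G₀ * a₁ * (a₂ * p + b₂ * G₂) + b₀ * G₀ * b₁ * G₁ * a₂ + b₀ * b₁ * b₂ * H, ?_⟩
    linear_combination (-(b₀ * b₁ * b₂)) * h
  refine Ideal.mul_le.mpr fun w hw z hz => ?_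
  refine Submodule.mul_induction_on hw (fun x hx y hy => key x hx y hy z hz) ?_
  intro u v hu hv
  rw [add_mul]
  exact Ideal.add_mem _ hu hv

/-- **`N((p, x)) ∣ |N(x)|`.** [folklore] -/
theorem absNorm_span_pair_dvd_natAbs_norm (p : ℕ) (x : 𝓞 K) :
    absNorm (span {(p : 𝓞 K), x}) ∣ (Algebra.norm ℤ x).natAbs := by
  have h := Ideal.absNorm_dvd_absNorm_of_le
    (show span {x} ≤ span {(p : 𝓞 K), x} from span_mono (Set.subset_insert _ _))
  rwa [absNorm_span_singleton] at h

/-- **`N((p, x)) ∣ p ^ [K : ℚ]`.** [folklore] -/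
theorem absNorm_span_pair_dvd_pow (p : ℕ) (x : 𝓞 K) :
    absNorm (span {(p : 𝓞 K), x}) ∣ p ^ Module.finrank ℚ K := by
  have h := Ideal.absNorm_dvd_absNorm_of_le
    (show span {(p : 𝓞 K)} ≤ span {(p : 𝓞 K), x} from
      span_mono (Set.singleton_subset_iff.mpr (Set.mem_insert _ _)))
  have hn : (Algebra.norm ℤ ((p : ℕ) : 𝓞 K)).natAbs = p ^ Module.finrank ℚ K := by
    rw [show ((p : ℕ) : 𝓞 K) = algebraMap ℤ (𝓞 K) (p : ℤ) by simp, Algebra.norm_algebraMap,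
      RingOfIntegers.rank, Int.natAbs_pow, Int.natAbs_natCast]
  rwa [absNorm_span_singleton, hn] at h

/-- Arithmetic core: `aᵢ ∣ p` (`i < 3`) and `p³ ∣ a₀a₁a₂` force `aᵢ = p`. [folklore] -/
theorem eq_of_dvd_prime_of_cube_dvd {p : ℕ} (hp : p.Prime) {a₀ a₁ a₂ : ℕ} (h₀ : a₀ ∣ p)
    (h₁ : a₁ ∣ p) (h₂ : a₂ ∣ p) (h : p ^ 3 ∣ a₀ * a₁ * a₂) : a₀ = p ∧ a₁ = p ∧ a₂ = p := by
  have hlt : ¬ p ^ 3 ∣ p * p := by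
    intro h3
    have hle : p ^ 3 ≤ p ^ 2 := by
      rw [pow_two]; exact Nat.le_of_dvd (Nat.mul_pos hp.pos hp.pos) h3
    exact absurd hle (not_le.mpr (Nat.pow_lt_pow_right hp.one_lt (by norm_num)))
  rcases (Nat.dvd_prime hp).mp h₀ with rfl | rfl
  · exact absurd (h.trans (by rw [one_mul]; exact Nat.mul_dvd_mul h₁ h₂)) hlt
  rcases (Nat.dvd_prime hp).mp h₁ with rfl | rfl
  · exact absurd (h.trans (by rw [mul_one]; exact Nat.mul_dvd_mul dvd_rfl h₂)) hlt
  rcases (Nat.dvd_prime hp).mp h₂ with rfl | rfl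
  · exact absurd (h.trans (by rw [mul_one])) hlt
  exact ⟨rfl, rfl, rfl⟩

/-- **The three primes above a totally split `p`, from a norm certificate (no Dedekind–Kummer).**
In a cubic field: if `G₀G₁G₂ = pH` and `|N(Gᵢ)| = p·mᵢ` with `p ∤ mᵢ`, then every `(p, Gᵢ)` is a
prime above `p` of norm `p`, and every prime containing `p` is one of them.
[cite: Cohen1993, §4.8.2, §6.2.2; Marcus2018, Ch. 3, Thm. 22] -/
theorem primesOver_three_of_normCert (h3 : Module.finrank ℚ K = 3) {p : ℕ} (hp : p.Prime)
    (G₀ G₁ G₂ H : 𝓞 K) (hprod : G₀ * G₁ * G₂ = p * H) (m₀ m₁ m₂ : ℕ)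
    (hN₀ : (Algebra.norm ℤ G₀).natAbs = p * m₀) (hN₁ : (Algebra.norm ℤ G₁).natAbs = p * m₁)
    (hN₂ : (Algebra.norm ℤ G₂).natAbs = p * m₂) (hm₀ : ¬ p ∣ m₀) (hm₁ : ¬ p ∣ m₁)
    (hm₂ : ¬ p ∣ m₂) :
    ((span {(p : 𝓞 K), G₀} ∈ primesOver (span {(p : ℤ)}) (𝓞 K) ∧
          absNorm (span {(p : 𝓞 K), G₀}) = p) ∧
        (span {(p : 𝓞 K), G₁} ∈ primesOver (span {(p : ℤ)}) (𝓞 K) ∧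
          absNorm (span {(p : 𝓞 K), G₁}) = p) ∧
        (span {(p : 𝓞 K), G₂} ∈ primesOver (span {(p : ℤ)}) (𝓞 K) ∧
          absNorm (span {(p : 𝓞 K), G₂}) = p)) ∧
      ∀ P : Ideal (𝓞 K), P.IsPrime → (p : 𝓞 K) ∈ P →
        P = span {(p : 𝓞 K), G₀} ∨ P = span {(p : 𝓞 K), G₁} ∨ P = span {(p : 𝓞 K), G₂} := by
  have hdvd : ∀ (x : 𝓞 K) (n : ℕ), (Algebra.norm ℤ x).natAbs = p * n → ¬ p ∣ n →
      absNorm (span {(p : 𝓞 K), x}) ∣ p := by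
    intro x n hN hn
    have h1 := absNorm_span_pair_dvd_pow p x
    rw [h3] at h1
    have h2 := absNorm_span_pair_dvd_natAbs_norm p x
    rw [hN] at h2
    obtain ⟨j, -, hje⟩ := (Nat.dvd_prime_pow hp).mp h1
    rw [hje] at h2 ⊢
    rcases j with _ | j
    · simp
    rcases j with _ | j
    · simp
    exfalso
    apply hn
    have h4 : p * p ∣ p * n := (pow_two p ▸ pow_dvd_pow p (by omega : 2 ≤ j + 2)).trans h2
    exact Nat.dvd_of_mul_dvd_mul_left hp.pos h4
  have hle := span_pair_mul_three_le (p := (p : 𝓞 K)) hprod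
  have hcube : p ^ 3 ∣ absNorm (span {(p : 𝓞 K), G₀}) * absNorm (span {(p : 𝓞 K), G₁}) *
      absNorm (span {(p : 𝓞 K), G₂}) := by
    have h := Ideal.absNorm_dvd_absNorm_of_le hle
    have hn : (Algebra.norm ℤ ((p : ℕ) : 𝓞 K)).natAbs = p ^ 3 := by
      rw [show ((p : ℕ) : 𝓞 K) = algebraMap ℤ (𝓞 K) (p : ℤ) by simp, Algebra.norm_algebraMap,
        RingOfIntegers.rank, h3, Int.natAbs_pow, Int.natAbs_natCast]
    rwa [absNorm_span_singleton, hn, map_mul, map_mul] at h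
  obtain ⟨e₀, e₁, e₂⟩ := eq_of_dvd_prime_of_cube_dvd hp (hdvd G₀ m₀ hN₀ hm₀) (hdvd G₁ m₁ hN₁ hm₁)
    (hdvd G₂ m₂ hN₂ hm₂) hcube
  have hP : ∀ (x : 𝓞 K), absNorm (span {(p : 𝓞 K), x}) = p →
      span {(p : 𝓞 K), x} ∈ primesOver (span {(p : ℤ)}) (𝓞 K) ∧
        absNorm (span {(p : 𝓞 K), x}) = p := by
    intro x hx
    have hprime : (span {(p : 𝓞 K), x}).IsPrime :=
      Ideal.isPrime_of_irreducible_absNorm (hx.symm ▸ hp)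
    exact ⟨MonicCubic.mem_primesOver_of_mem hprime hp (subset_span (Set.mem_insert _ _)), hx⟩
  refine ⟨⟨hP G₀ e₀, hP G₁ e₁, hP G₂ e₂⟩, fun P hPp hpP => ?_⟩
  have hprod' : ∏ i, (![G₀, G₁, G₂] : Fin 3 → 𝓞 K) i ^ (fun _ => 1 : Fin 3 → ℕ) i = p * H := by
    simp only [pow_one, Fin.prod_univ_three, Matrix.cons_val_zero, Matrix.cons_val_one,
      Matrix.head_cons, Matrix.cons_val_two, Matrix.tail_cons]
    exact hprod
  have hmax : ∀ i, (span {(p : 𝓞 K), (![G₀, G₁, G₂] : Fin 3 → 𝓞 K) i}).IsMaximal := by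
    intro i
    fin_cases i
    · exact (hP G₀ e₀).1.1.isMaximal (span_pair_ne_bot hp _)
    · exact (hP G₁ e₁).1.1.isMaximal (span_pair_ne_bot hp _)
    · exact (hP G₂ e₂).1.1.isMaximal (span_pair_ne_bot hp _)
  obtain ⟨i, hi⟩ := exists_eq_span_pair_of_prod_eq p _ (fun _ => 1) H hprod' hmax P hPp hpP
  fin_cases i
  · exact Or.inl hi
  · exact Or.inr (Or.inl hi)
  · exact Or.inr (Or.inr hi)

omit [NumberField K] in
/-- Covering in `HeightOneSpectrum` form, three primes. [folklore] -/
theorem heightOneSpectrum_eq_or_eq_or_eq {p : ℕ} {I₁ I₂ I₃ : Ideal (𝓞 K)}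
    (hcov : ∀ P : Ideal (𝓞 K), P.IsPrime → (p : 𝓞 K) ∈ P → P = I₁ ∨ P = I₂ ∨ P = I₃)
    (w₁ w₂ w₃ : HeightOneSpectrum (𝓞 K)) (h₁ : w₁.asIdeal = I₁) (h₂ : w₂.asIdeal = I₂)
    (h₃ : w₃.asIdeal = I₃) (w : HeightOneSpectrum (𝓞 K)) (hw : (p : 𝓞 K) ∈ w.asIdeal) :
    w = w₁ ∨ w = w₂ ∨ w = w₃ := by
  rcases hcov w.asIdeal w.isPrime hw with h | h | h
  · exact Or.inl (HeightOneSpectrum.ext (h.trans h₁.symm))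
  · exact Or.inr (Or.inl (HeightOneSpectrum.ext (h.trans h₂.symm)))
  · exact Or.inr (Or.inr (HeightOneSpectrum.ext (h.trans h₃.symm)))

omit [NumberField K] in
/-- **Two ideals containing complementary elements are distinct**: `x ∈ w₁`, `y ∈ w₂`, `y − x = 1`
give `w₁ ≠ w₂`. [folklore] -/
theorem ne_of_sub_eq_one {w₁ w₂ : HeightOneSpectrum (𝓞 K)} {x y : 𝓞 K} (hx : x ∈ w₁.asIdeal)
    (hy : y ∈ w₂.asIdeal) (h : y - x = 1) : w₁ ≠ w₂ := by
  rintro rfl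
  have h1 : (1 : 𝓞 K) ∈ w₁.asIdeal := by rw [← h]; exact Ideal.sub_mem _ hy hx
  exact w₁.isPrime.ne_top ((Ideal.eq_top_iff_one _).mpr h1)

end Summit.BirchSwinnertonDyer.BirchSwinnertonDyer.Rank2Observatory.TwoDescCl

end
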